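import Summits.ABC.IUTFork.Cor312LogKummerRoute
import Summits.ABC.IUTFork.Cor312VolumesRealFrames
import Summits.ABC.IUTFork.Cor312VolumesSummands
import HarnessLib

/-!
# [IUTchIII] Cor. 3.12, TEAM B rows B-3/B-4 (weighted containers): `ThetaRegionsAdm`, `m`-independence of the
# single Kummer-image volumes and the uniform B-INPUT — over the VERBATIM weighted containers and at the frames setting

Record-only file (D-0012) of the abc-iut cell (Cor. 3.12 strategy TEAM B «estimate / log-Kummer», HUMAN RULING
D-0067 (3), rows B-3/B-4 of `HOME/plan/C312-TEAMS.md`, seat abc-iut-c312-6 gen 3); PROOF-ONLY; TAKES NO SIDE.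
abc-iut-c312-11's log-Kummer route (`Cor312LogKummerRoute`, p411119) reduces the printed `Statement` of
[IUTchIII] Cor. 3.12 to `BridgeHyps` + `ThetaRegionsAdm P` (every `(n,m)`-Kummer image of the Θ-pilot object is an
admissible region of Thm. 3.11 (i) (a)) + the B-INPUT `VolumeTransport P` ([IUTchIII] p. 184 l. 30–34, Step
(xi-g): "two tautologically equivalent ways to compute the log-volume of the `q`-pilot object", ≤-form).
abc-iut-c312-12's `Cor312ThetaAdmReal` (p413177) discharges `ThetaRegionsAdm` and collapses the `∃ m` of the
B-INPUT when the volumes are read through ONE container with a normalised Haar measure per packet (the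
Dupuy–Hilado-normalised model, `log μ̄ = (1/dim)·log μ`). The VERBATIM containers are WEIGHTED SUMS —
abc-iut-c312-5's `SummandPieces` ([IUTchIII] Rmk. 3.1.1 (ii)(iii) pp. 94–96: direct product regions over the
summands `v⃗`, `Σ_{v⃗} w_{v⃗}·log μ_{v⃗}`) and abc-iut-c312-6's all-places `FrameVolumePieces` (field-factor boxes,
`Σ_i w_i·log vol_i`, radial volume at complex factors, [AbsTopIII] Prop. 5.7 (ii)) — so this file gives the weighted
counterparts, with the Kummer isomorphisms realised as in `Cor312KummerVolumeFrames` (p413059):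

* §1 `FrameVolumePieces.thetaRegionsAdm_of_factorwiseRealisations`: if the line `S.D P.n` realises `V`, each
  `m`-th Kummer image of the Θ-pilot object is, on `Π_i K_i`, the image under the FACTORWISE realisation
  `Π_i φ_{m,i}` (each `φ_{m,i}` preserving `vol_i`) of ONE reference region which is `V`-admissible (a box with
  factors of positive finite volume — [IUTchIII] Prop. 3.9 (i) p. 115: regions in "`𝕄(−)`"), then
  **`ThetaRegionsAdm P`**; `logvol_thetaRegion_eq_of_factorwiseRealisations`: every single image has the SAME
  log-volume `Σ_i w_i·log vol_i(R_i)` (the region-level form of Thm. 3.11 (ii)'s final "[precisely!]" clause,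
  p. 156 / Prop. 3.9 (iv) p. 117); `volumeTransport_iff_at_of_factorwiseRealisations`: the `∃ m` of the B-INPUT
  COLLAPSES to the uniform `VolumeTransportAt P m₀` at any fixed `m₀`.
* §2 the same three over the VERBATIM `SummandPieces` for realisations in abc-iut-c312-5's `PreservesRegions`.
* §3 AT THE FRAMES SETTING (abc-iut-c312-7 `Setting.ofFrames`, where `thetaRegion m = e⁻¹(Θ-box_m)` and the
  `q`-region is the hull-set of the `q̲`-centre): `thetaRegionsAdm_ofFrames` — if every Θ-box at a label in `𝔽_l^⋇` is
  a product of factor sets of positive finite volume, `ThetaRegionsAdm` HOLDS (no realisation needed); and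
  **`volumeTransportAt_ofFrames_iff`** — the uniform B-INPUT at position `m` IS, packet by packet, the CLOSED
  NUMERIC INEQUALITY `Σ_i w_i·μ̇^log_i(q̲_i) ≤ Σ_i w_i·log vol_i(Θ-box_{m,i})` (gen-2 `qLocal_ofFrames` +
  `logvol_preimage_pi`): the adjudication target of TEAM B at the frames setting, in numbers — NOT asserted;
  `thetaRegionsAdm_ofFrames_of_isHullSet` / `volumeTransportAt_ofFrames_iff_of_hullSet`: the hull-set Θ-box case
  (`λ_m·𝒪_L`; printed Θ-pilot regions `q^{j²}·𝒪`, Rmk. 3.9.5 (ii) p. 127): admissible outright, and the B-INPUT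
  reads `Σ_k w_k·μ̇^log_k(q̲_k) ≤ Σ_k w_k·μ̇^log_k(λ_{m,k})`.

Sources read on the page (kurims `paper:url-4b091feeb646`): [IUTchIII] pp. 94–96 (Rmk. 3.1.1 (ii)(iii)), pp. 115–117
(Prop. 3.9 (i)(iv)), pp. 155–156 (Thm. 3.11 (ii)), p. 184 (Step (xi-g)). [claim: Mochizuki2012, status: disputed]
Everything proved is bookkeeping; NO new definition, NO new `Prop`. Deliberately NOT here: `VolumeTransport` itself
(the B-INPUT; plan/GAP-LEDGER G-c312-11-1), `BridgeHyps` (abc-iut-c312-5 A-0), which `φ_{m,i}` / Θ-boxes the printed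
Kummer isomorphisms and Θ-pilot regions ARE at the real carriers (abc-iut-c312-3 / c312-5 instance data), judgement.
-/

noncomputable section

open Set MeasureTheory Metric
open scoped ENNReal

namespace Summit.ABC

namespace IUTFork

namespace Cor312Vol

open Thm311 Cor312 Literature.IUT.LogVolume Literature.IUT.LogThetaLattice

variable {T : ThetaIndex} {S : Situation T} (P : Cor312.Setting S)

/-! ## 1. The all-places container: factorwise realisations of one admissible reference region -/

namespace FrameVolumePieces

variable (V : FrameVolumePieces S.L)
  (φ : ℤ → ∀ (j : T.Label) (vQ : T.VQ) (i : V.J j vQ), V.K j vQ i → V.K j vQ i)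
  (R : ∀ (j : T.Label) (vQ : T.VQ), Set (S.L.Packet j vQ))

/-- **`ThetaRegionsAdm P` from factorwise realisations of ONE admissible reference region** (TEAM B row B-3 at the
weighted all-places container): if the line realises `V`, each `m`-th Kummer image of the Θ-pilot object is — read
on `Π_i K_i` — the factorwise transport `Π_i φ_{m,i}` of a `V`-admissible reference region, and every `φ_{m,i}`
preserves `vol_i`, then every Kummer image is admissible ([IUTchIII] Prop. 3.9 (i) p. 115; Thm. 3.11 (ii) (a) p. 155).
[claim: Mochizuki2012, status: disputed] -/
theorem thetaRegionsAdm_of_factorwiseRealisations (hV : V.Realizes (S.D P.n))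
    (hφ : ∀ (m : ℤ) (j : T.Label) (vQ : T.VQ) (i : V.J j vQ) (A : Set (V.K j vQ i)),
      (V.vol j vQ i).vol (φ m j vQ i '' A) = (V.vol j vQ i).vol A)
    (hthetaEq : ∀ (m : ℤ) (i : Fin T.lstar) (vQ : T.VQ),
      V.e (Setting.labelSucc i) vQ '' P.thetaRegion m (Setting.labelSucc i) vQ =
        Pi.map (φ m (Setting.labelSucc i) vQ) '' (V.e (Setting.labelSucc i) vQ '' R (Setting.labelSucc i) vQ))
    (hR : ∀ (i : Fin T.lstar) (vQ : T.VQ), V.Adm (Setting.labelSucc i) vQ (R (Setting.labelSucc i) vQ)) :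
    ThetaRegionsAdm P := by
  intro m i vQ
  rw [hV.adm_iff]
  obtain ⟨R₀, hR₀, hR₀'⟩ := hR i vQ
  refine ⟨fun k => φ m _ vQ k '' R₀ k, ?_, fun k => ?_⟩
  · rw [hthetaEq, hR₀]
    exact Set.piMap_image_univ_pi _ R₀
  · rw [hφ]
    exact hR₀' k

/-- **CLOSED FORM of the single-image log-volumes**: under the same data, the `m`-th Kummer image has log-volume
`Σ_i w_i·log vol_i(R_i)` — the weighted factor volumes of the reference box, whatever `m`.
[claim: Mochizuki2012, status: disputed] -/
theorem logvol_thetaRegion_eq_sum_of_factorwiseRealisations (hV : V.Realizes (S.D P.n))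
    (hφ : ∀ (m : ℤ) (j : T.Label) (vQ : T.VQ) (i : V.J j vQ) (A : Set (V.K j vQ i)),
      (V.vol j vQ i).vol (φ m j vQ i '' A) = (V.vol j vQ i).vol A)
    (hthetaEq : ∀ (m : ℤ) (i : Fin T.lstar) (vQ : T.VQ),
      V.e (Setting.labelSucc i) vQ '' P.thetaRegion m (Setting.labelSucc i) vQ =
        Pi.map (φ m (Setting.labelSucc i) vQ) '' (V.e (Setting.labelSucc i) vQ '' R (Setting.labelSucc i) vQ))
    (m : ℤ) (i : Fin T.lstar) (vQ : T.VQ) {R₀ : ∀ k, Set (V.K (Setting.labelSucc i) vQ k)}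
    (hR₀ : V.e (Setting.labelSucc i) vQ '' R (Setting.labelSucc i) vQ = Set.pi univ R₀) (hne : ∀ k, (R₀ k).Nonempty) :
    (S.D P.n).logvol (Setting.labelSucc i) vQ (P.thetaRegion m (Setting.labelSucc i) vQ) =
      ∑ k, V.w (Setting.labelSucc i) vQ k * (V.vol (Setting.labelSucc i) vQ k).logvol (R₀ k) := by
  rw [hV.logvol_eq]
  unfold FrameVolumePieces.logvol
  rw [hthetaEq, hR₀, Set.piMap_image_univ_pi]
  refine Finset.sum_congr rfl fun k _ => ?_
  rw [Set.eval_image_univ_pi (Set.univ_pi_nonempty_iff.mpr fun k => (hne k).image _)]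
  unfold FactorVolume.logvol
  rw [hφ]

/-- **The single-image log-volumes do not depend on `m`** (region-level form of Thm. 3.11 (ii)'s final
"[precisely!]" clause p. 156 / Prop. 3.9 (iv) p. 117), at the weighted all-places container.
[claim: Mochizuki2012, status: disputed] -/
theorem logvol_thetaRegion_eq_of_factorwiseRealisations (hV : V.Realizes (S.D P.n))
    (hφ : ∀ (m : ℤ) (j : T.Label) (vQ : T.VQ) (i : V.J j vQ) (A : Set (V.K j vQ i)),
      (V.vol j vQ i).vol (φ m j vQ i '' A) = (V.vol j vQ i).vol A)
    (hthetaEq : ∀ (m : ℤ) (i : Fin T.lstar) (vQ : T.VQ),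
      V.e (Setting.labelSucc i) vQ '' P.thetaRegion m (Setting.labelSucc i) vQ =
        Pi.map (φ m (Setting.labelSucc i) vQ) '' (V.e (Setting.labelSucc i) vQ '' R (Setting.labelSucc i) vQ))
    (hR : ∀ (i : Fin T.lstar) (vQ : T.VQ), V.Adm (Setting.labelSucc i) vQ (R (Setting.labelSucc i) vQ))
    (m m' : ℤ) (i : Fin T.lstar) (vQ : T.VQ) :
    (S.D P.n).logvol (Setting.labelSucc i) vQ (P.thetaRegion m (Setting.labelSucc i) vQ) =
      (S.D P.n).logvol (Setting.labelSucc i) vQ (P.thetaRegion m' (Setting.labelSucc i) vQ) := by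
  obtain ⟨R₀, hR₀, hR₀'⟩ := hR i vQ
  have hne : ∀ k, (R₀ k).Nonempty := fun k => (V.vol _ vQ k).nonempty_of_vol_ne_zero (hR₀' k).1
  rw [V.logvol_thetaRegion_eq_sum_of_factorwiseRealisations P φ R hV hφ hthetaEq m i vQ hR₀ hne,
    V.logvol_thetaRegion_eq_sum_of_factorwiseRealisations P φ R hV hφ hthetaEq m' i vQ hR₀ hne]

/-- **The `∃ m` of the B-INPUT collapses** at the weighted all-places container: `VolumeTransport P` is
equivalent to the uniform `VolumeTransportAt P m₀` at ANY fixed position (e.g. the gluing position of Step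
(xi-a)). [claim: Mochizuki2012, status: disputed] -/
theorem volumeTransport_iff_at_of_factorwiseRealisations (hV : V.Realizes (S.D P.n))
    (hφ : ∀ (m : ℤ) (j : T.Label) (vQ : T.VQ) (i : V.J j vQ) (A : Set (V.K j vQ i)),
      (V.vol j vQ i).vol (φ m j vQ i '' A) = (V.vol j vQ i).vol A)
    (hthetaEq : ∀ (m : ℤ) (i : Fin T.lstar) (vQ : T.VQ),
      V.e (Setting.labelSucc i) vQ '' P.thetaRegion m (Setting.labelSucc i) vQ =
        Pi.map (φ m (Setting.labelSucc i) vQ) '' (V.e (Setting.labelSucc i) vQ '' R (Setting.labelSucc i) vQ))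
    (hR : ∀ (i : Fin T.lstar) (vQ : T.VQ), V.Adm (Setting.labelSucc i) vQ (R (Setting.labelSucc i) vQ))
    (m₀ : ℤ) : VolumeTransport P ↔ VolumeTransportAt P m₀ := by
  refine ⟨fun h i vQ => ?_, volumeTransport_of_at⟩
  obtain ⟨m, hm⟩ := h i vQ
  exact hm.trans_eq
    (V.logvol_thetaRegion_eq_of_factorwiseRealisations P φ R hV hφ hthetaEq hR m m₀ i vQ)

end FrameVolumePieces

/-! ## 2. The VERBATIM summandwise container: container-preserving realisations -/

namespace SummandPieces

variable (V : SummandPieces S.L)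
  (Ψ : ℤ → ∀ (j : T.Label) (vQ : T.VQ), (∀ e, V.X j vQ e) → ∀ e, V.X j vQ e)
  (R : ∀ (j : T.Label) (vQ : T.VQ), Set (S.L.Packet j vQ))

/-- **`ThetaRegionsAdm P` over the verbatim container of [IUTchIII] Rmk. 3.1.1 (iii)** (direct product regions
over the summands): if the line realises `V`, each `m`-th Kummer image of the Θ-pilot object is, on `Π_{v⃗} M_{v⃗}`,
the transport by a container-preserving `Ψ_m` (abc-iut-c312-5 `PreservesRegions`) of ONE `V`-admissible reference
region, then every Kummer image is admissible. [claim: Mochizuki2012, status: disputed] -/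
theorem thetaRegionsAdm_of_preservesRegions (hV : V.Realizes (S.D P.n))
    (hΨ : ∀ (m : ℤ) (j : T.Label) (vQ : T.VQ), V.PreservesRegions j vQ (Ψ m j vQ))
    (hthetaEq : ∀ (m : ℤ) (i : Fin T.lstar) (vQ : T.VQ),
      V.e (Setting.labelSucc i) vQ '' P.thetaRegion m (Setting.labelSucc i) vQ =
        Ψ m (Setting.labelSucc i) vQ '' (V.e (Setting.labelSucc i) vQ '' R (Setting.labelSucc i) vQ))
    (hR : ∀ (i : Fin T.lstar) (vQ : T.VQ), V.Adm (Setting.labelSucc i) vQ (R (Setting.labelSucc i) vQ)) :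
    ThetaRegionsAdm P := by
  intro m i vQ
  rw [hV.adm_iff]
  obtain ⟨R₀, hR₀, hadm⟩ := hR i vQ
  obtain ⟨R', hR', hadm', -⟩ := (hΨ m _ vQ).map_pi R₀ hadm
  exact ⟨R', by rw [hthetaEq, hR₀, hR'], hadm'⟩

/-- **The single-image log-volumes equal the reference's** over the verbatim container (hence do not depend on
`m`). [claim: Mochizuki2012, status: disputed] -/
theorem logvol_thetaRegion_eq_ref_of_preservesRegions (hV : V.Realizes (S.D P.n))
    (hΨ : ∀ (m : ℤ) (j : T.Label) (vQ : T.VQ), V.PreservesRegions j vQ (Ψ m j vQ))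
    (hthetaEq : ∀ (m : ℤ) (i : Fin T.lstar) (vQ : T.VQ),
      V.e (Setting.labelSucc i) vQ '' P.thetaRegion m (Setting.labelSucc i) vQ =
        Ψ m (Setting.labelSucc i) vQ '' (V.e (Setting.labelSucc i) vQ '' R (Setting.labelSucc i) vQ))
    (hR : ∀ (i : Fin T.lstar) (vQ : T.VQ), V.Adm (Setting.labelSucc i) vQ (R (Setting.labelSucc i) vQ))
    (m : ℤ) (i : Fin T.lstar) (vQ : T.VQ) :
    (S.D P.n).logvol (Setting.labelSucc i) vQ (P.thetaRegion m (Setting.labelSucc i) vQ) =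
      (S.D P.n).logvol (Setting.labelSucc i) vQ (R (Setting.labelSucc i) vQ) := by
  obtain ⟨R₀, hR₀, hadm⟩ := hR i vQ
  obtain ⟨R', hR', hadm', hvol⟩ := (hΨ m _ vQ).map_pi R₀ hadm
  rw [hV.logvol_eq, hV.logvol_eq, logvol_eq_of_pi (by rw [hthetaEq, hR₀, hR']) hadm', logvol_eq_of_pi hR₀ hadm, hvol]

/-- **The `∃ m` of the B-INPUT collapses** over the verbatim container: `VolumeTransport P ↔ VolumeTransportAt P m₀`
for any fixed `m₀`. [claim: Mochizuki2012, status: disputed] -/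
theorem volumeTransport_iff_at_of_preservesRegions (hV : V.Realizes (S.D P.n))
    (hΨ : ∀ (m : ℤ) (j : T.Label) (vQ : T.VQ), V.PreservesRegions j vQ (Ψ m j vQ))
    (hthetaEq : ∀ (m : ℤ) (i : Fin T.lstar) (vQ : T.VQ),
      V.e (Setting.labelSucc i) vQ '' P.thetaRegion m (Setting.labelSucc i) vQ =
        Ψ m (Setting.labelSucc i) vQ '' (V.e (Setting.labelSucc i) vQ '' R (Setting.labelSucc i) vQ))
    (hR : ∀ (i : Fin T.lstar) (vQ : T.VQ), V.Adm (Setting.labelSucc i) vQ (R (Setting.labelSucc i) vQ))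
    (m₀ : ℤ) : VolumeTransport P ↔ VolumeTransportAt P m₀ := by
  refine ⟨fun h i vQ => ?_, volumeTransport_of_at⟩
  obtain ⟨m, hm⟩ := h i vQ
  exact hm.trans_eq
    ((V.logvol_thetaRegion_eq_ref_of_preservesRegions P Ψ R hV hΨ hthetaEq hR m i vQ).trans
      (V.logvol_thetaRegion_eq_ref_of_preservesRegions P Ψ R hV hΨ hthetaEq hR m₀ i vQ).symm)

end SummandPieces

/-! ## 3. At the frames setting: Θ-boxes and the B-INPUT in closed numeric form -/

namespace FrameVolumePieces

section Assembled

variable {V : FrameVolumePieces S.L} {n : ℤ}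
  {HT : Type} {LogLink : HT → HT → Type} {IsFull : ∀ {s t : HT}, LogLink s t → Prop}
  (lat : LGPGaussianLogThetaLattice LogLink IsFull)
  {Frd : Type} {IsoF : Frd → Frd → Type} {Ob : Frd → Type} {realify : Frd → Frd} {Strip : Type}
  {IsoS : Strip → Strip → Type} {M : ∀ v : T.V, v ∈ T.Vbad → Type} [∀ v h, Monoid (M v h)]
  (sig : GlobalLGPFrobenioidSignature T.lstar T.V (· ∈ T.Vbad) Frd IsoF Ob realify Strip IsoS M)
  (split : SplittingMonoids M) {ObΔ : Type} {N : ∀ v : T.V, v ∈ T.Vbad → Type} [∀ v h, Monoid (N v h)]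
  (qData : QPilotData ObΔ N)
  (thetaBox : ℤ → Ob sig.Clgp → ∀ j vQ, Set (∀ i, V.K j vQ i))
  (qCentre : ObΔ → ∀ j vQ, ∀ i, V.K j vQ i)
  (hq : ∀ j vQ i, qCentre (qPilotObject qData) j vQ i ≠ 0)
  (hadm : ∀ j vQ (H : Set (∀ i, V.K j vQ i)), IsHullSet (V.K j vQ) H → (S.D n).Adm j vQ (V.e j vQ ⁻¹' H))
  (hfin : ∀ j : T.Label, (Function.support fun vQ => (S.D n).logvol j vQ
    (V.e j vQ ⁻¹' hullSet (V.K j vQ) (qCentre (qPilotObject qData) j vQ))).Finite)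
  (B : ℤ → ∀ (i : Fin T.lstar) (vQ : T.VQ) (k : V.J (Setting.labelSucc i) vQ), Set (V.K (Setting.labelSucc i) vQ k))

/-- **`ThetaRegionsAdm` at the frames setting from the SHAPE of the Θ-boxes** (no realisation needed): if the line
realises `V` and every Θ-box of the Θ-pilot object at a label `j ∈ 𝔽_l^⋇` is a product `Π_k B_{m,k}` of factor sets of
positive finite volume (e.g. polydiscs `q^{j²}·𝒪`, hull-sets), then every Kummer image `e⁻¹(Θ-box_m)` is admissible.
[claim: Mochizuki2012, status: disputed] -/
theorem thetaRegionsAdm_ofFrames (hV : V.Realizes (S.D n))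
    (hbox : ∀ (m : ℤ) (i : Fin T.lstar) (vQ : T.VQ),
      thetaBox m (thetaPilotObject sig split) (Setting.labelSucc i) vQ = Set.pi univ (B m i vQ))
    (hB : ∀ (m : ℤ) (i : Fin T.lstar) (vQ : T.VQ) (k : V.J (Setting.labelSucc i) vQ),
      (V.vol _ vQ k).vol (B m i vQ k) ≠ 0 ∧ (V.vol _ vQ k).vol (B m i vQ k) ≠ ∞) :
    ThetaRegionsAdm (Setting.ofFrames n lat sig split qData (V.toRealFrames thetaBox qCentre) hq hadm hfin) := by
  intro m i vQ
  show (S.D n).Adm _ vQ (V.e _ vQ ⁻¹' thetaBox m (thetaPilotObject sig split) (Setting.labelSucc i) vQ)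
  rw [hV.adm_iff]
  exact ⟨B m i vQ, by rw [Set.image_preimage_eq _ (V.e_surjective _ vQ), hbox], hB m i vQ⟩

/-- The log-volume of the `m`-th Kummer image at the frames setting, in CLOSED FORM: `Σ_k w_k·log vol_k(B_{m,k})`.
[claim: Mochizuki2012, status: disputed] -/
theorem logvol_thetaRegion_ofFrames (hV : V.Realizes (S.D n))
    (hbox : ∀ (m : ℤ) (i : Fin T.lstar) (vQ : T.VQ),
      thetaBox m (thetaPilotObject sig split) (Setting.labelSucc i) vQ = Set.pi univ (B m i vQ))
    (hB : ∀ (m : ℤ) (i : Fin T.lstar) (vQ : T.VQ) (k : V.J (Setting.labelSucc i) vQ),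
      (V.vol _ vQ k).vol (B m i vQ k) ≠ 0 ∧ (V.vol _ vQ k).vol (B m i vQ k) ≠ ∞)
    (m : ℤ) (i : Fin T.lstar) (vQ : T.VQ) :
    (S.D (Setting.ofFrames n lat sig split qData (V.toRealFrames thetaBox qCentre) hq hadm hfin).n).logvol _ vQ
        ((Setting.ofFrames n lat sig split qData (V.toRealFrames thetaBox qCentre) hq hadm hfin).thetaRegion m
          (Setting.labelSucc i) vQ) =
      ∑ k, V.w _ vQ k * (V.vol _ vQ k).logvol (B m i vQ k) := by
  show (S.D n).logvol _ vQ (V.e _ vQ ⁻¹' thetaBox m (thetaPilotObject sig split) (Setting.labelSucc i) vQ) = _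
  rw [hV.logvol_eq, hbox]
  exact V.logvol_preimage_pi _ vQ fun k => (V.vol _ vQ k).nonempty_of_vol_ne_zero (hB m i vQ k).1

/-- **The uniform B-INPUT at the frames setting, in CLOSED NUMERIC FORM** (the adjudication target of TEAM B,
plan/GAP-LEDGER G-c312-11-1, READ at c312-7's per-place assembler — not asserted): `VolumeTransportAt P m` holds
iff in every packet `(j = i+1, v_ℚ)`
`Σ_k w_k·μ̇^log_k(q̲_k) ≤ Σ_k w_k·log vol_k(B_{m,k})` — the weighted log-moduli of the components of the `q`-pilot's
centre against the weighted factor volumes of the `m`-th Θ-box ([IUTchIII] Step (xi-g) p. 184; gen-2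
`qLocal_ofFrames`). [claim: Mochizuki2012, status: disputed] -/
theorem volumeTransportAt_ofFrames_iff (hV : V.Realizes (S.D n))
    (hbox : ∀ (m : ℤ) (i : Fin T.lstar) (vQ : T.VQ),
      thetaBox m (thetaPilotObject sig split) (Setting.labelSucc i) vQ = Set.pi univ (B m i vQ))
    (hB : ∀ (m : ℤ) (i : Fin T.lstar) (vQ : T.VQ) (k : V.J (Setting.labelSucc i) vQ),
      (V.vol _ vQ k).vol (B m i vQ k) ≠ 0 ∧ (V.vol _ vQ k).vol (B m i vQ k) ≠ ∞)
    (m : ℤ) :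
    VolumeTransportAt (Setting.ofFrames n lat sig split qData (V.toRealFrames thetaBox qCentre) hq hadm hfin) m ↔
      ∀ (i : Fin T.lstar) (vQ : T.VQ),
        ∑ k, V.w _ vQ k * (V.vol _ vQ k).mulLogvol (qCentre (qPilotObject qData) (Setting.labelSucc i) vQ k) ≤
          ∑ k, V.w _ vQ k * (V.vol _ vQ k).logvol (B m i vQ k) := by
  refine forall_congr' fun i => forall_congr' fun vQ => ?_
  rw [V.qLocal_ofFrames lat sig split qData thetaBox qCentre hq hadm hfin hV,
    logvol_thetaRegion_ofFrames lat sig split qData thetaBox qCentre hq hadm hfin B hV hbox hB m i vQ]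

/-- … hence the full B-INPUT `VolumeTransport` at the frames setting is that inequality at ANY one position `m₀`,
granting that the Θ-boxes at the other positions are factorwise volume-preserving transports of the `m₀`-th one
(`hvol`: equal factor volumes — Thm. 3.11 (ii) final clause at the boxes). [claim: Mochizuki2012, status: disputed] -/
theorem volumeTransport_ofFrames_iff (hV : V.Realizes (S.D n))
    (hbox : ∀ (m : ℤ) (i : Fin T.lstar) (vQ : T.VQ),
      thetaBox m (thetaPilotObject sig split) (Setting.labelSucc i) vQ = Set.pi univ (B m i vQ))
    (hB : ∀ (m : ℤ) (i : Fin T.lstar) (vQ : T.VQ) (k : V.J (Setting.labelSucc i) vQ),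
      (V.vol _ vQ k).vol (B m i vQ k) ≠ 0 ∧ (V.vol _ vQ k).vol (B m i vQ k) ≠ ∞)
    (m₀ : ℤ)
    (hvol : ∀ (m : ℤ) (i : Fin T.lstar) (vQ : T.VQ) (k : V.J (Setting.labelSucc i) vQ),
      (V.vol _ vQ k).vol (B m i vQ k) = (V.vol _ vQ k).vol (B m₀ i vQ k)) :
    VolumeTransport (Setting.ofFrames n lat sig split qData (V.toRealFrames thetaBox qCentre) hq hadm hfin) ↔
      ∀ (i : Fin T.lstar) (vQ : T.VQ),
        ∑ k, V.w _ vQ k * (V.vol _ vQ k).mulLogvol (qCentre (qPilotObject qData) (Setting.labelSucc i) vQ k) ≤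
          ∑ k, V.w _ vQ k * (V.vol _ vQ k).logvol (B m₀ i vQ k) := by
  rw [← volumeTransportAt_ofFrames_iff lat sig split qData thetaBox qCentre hq hadm hfin B hV hbox hB m₀]
  refine ⟨fun h i vQ => ?_, volumeTransport_of_at⟩
  obtain ⟨m, hm⟩ := h i vQ
  refine hm.trans_eq ?_
  rw [logvol_thetaRegion_ofFrames lat sig split qData thetaBox qCentre hq hadm hfin B hV hbox hB m i vQ,
    logvol_thetaRegion_ofFrames lat sig split qData thetaBox qCentre hq hadm hfin B hV hbox hB m₀ i vQ]
  refine Finset.sum_congr rfl fun k _ => ?_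
  unfold FactorVolume.logvol
  rw [hvol]

/-- **Hull-set Θ-boxes**: if every Θ-box at a label in `𝔽_l^⋇` is a hull-set `λ·𝒪_L = Π_k B(0,‖λ_k‖)` with all
`λ_k ≠ 0` (the shape of the printed Θ-pilot regions `q^{j²}·𝒪`, [IUTchIII] Rmk. 3.9.5 (ii) p. 127), then
`ThetaRegionsAdm` HOLDS at the frames setting — by gen-2's `hadm_of_realizes` (hull-sets are admissible).
[claim: Mochizuki2012, status: disputed] -/
theorem thetaRegionsAdm_ofFrames_of_isHullSet (hV : V.Realizes (S.D n))
    (hhull : ∀ (m : ℤ) (i : Fin T.lstar) (vQ : T.VQ),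
      IsHullSet (V.K _ vQ) (thetaBox m (thetaPilotObject sig split) (Setting.labelSucc i) vQ)) :
    ThetaRegionsAdm (Setting.ofFrames n lat sig split qData (V.toRealFrames thetaBox qCentre) hq hadm hfin) :=
  fun m i vQ => hadm_of_realizes hV _ vQ _ (hhull m i vQ)

/-- … and then the uniform B-INPUT at position `m` reads, packet by packet,
`Σ_k w_k·μ̇^log_k(q̲_k) ≤ Σ_k w_k·μ̇^log_k(λ_{m,k})` for the centres `λ_m` of the Θ-boxes — at nonarchimedean factors
`−Σ_k w_k·ord(q̲_k)·log q_k ≤ −Σ_k w_k·ord(λ_{m,k})·log q_k` (gen-2 `ofUltrametric_mulLogvol` + S8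
`mulLogVolume_eq_neg_ordFun`). NOT asserted. [claim: Mochizuki2012, status: disputed] -/
theorem volumeTransportAt_ofFrames_iff_of_hullSet (hV : V.Realizes (S.D n))
    (c : ℤ → ∀ (i : Fin T.lstar) (vQ : T.VQ) (k : V.J (Setting.labelSucc i) vQ), V.K (Setting.labelSucc i) vQ k)
    (hc : ∀ (m : ℤ) (i : Fin T.lstar) (vQ : T.VQ),
      thetaBox m (thetaPilotObject sig split) (Setting.labelSucc i) vQ = hullSet (V.K _ vQ) (c m i vQ))
    (m : ℤ) :
    VolumeTransportAt (Setting.ofFrames n lat sig split qData (V.toRealFrames thetaBox qCentre) hq hadm hfin) m ↔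
      ∀ (i : Fin T.lstar) (vQ : T.VQ),
        ∑ k, V.w _ vQ k * (V.vol _ vQ k).mulLogvol (qCentre (qPilotObject qData) (Setting.labelSucc i) vQ k) ≤
          ∑ k, V.w _ vQ k * (V.vol _ vQ k).mulLogvol (c m i vQ k) := by
  refine forall_congr' fun i => forall_congr' fun vQ => ?_
  rw [V.qLocal_ofFrames lat sig split qData thetaBox qCentre hq hadm hfin hV]
  show _ ≤ (S.D n).logvol _ vQ (V.e _ vQ ⁻¹' thetaBox m (thetaPilotObject sig split) (Setting.labelSucc i) vQ) ↔ _
  rw [hc, hV.logvol_eq, V.logvol_preimage_hullSet]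

/-- **The `j²`-obstruction in CLOSED NUMBERS at the frames setting** (appended 2026-08-26; the auditor's note N2 on
p413564 and abc-iut-c312-11's remark on GAP row G-c312-11-1 made kernel-explicit; TEAM R support — cf.
abc-iut-c312-15's `Cor312IdentifiedScaled` at the abstract setting). If, in some packet `(j = i+1, v_ℚ)`, the centre
`λ_m` of the `m`-th hull-set Θ-box has factorwise log-moduli `μ̇^log_k(λ_{m,k}) = s·μ̇^log_k(q̲_k)` for a scale `s > 1`
(the printed Θ-pilot at label `j` is `q̲^{j²}` against the `q`-pilot's `q̲` — [IUTchIII] Def. 3.8 (i) p. 112 /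
[IUTchII] Cor. 4.10 (i): `s = j² ≥ 4` for `j ≥ 2` — WITH IDENTICAL COORDINATES on both sides, i.e. no
(Ind1)(Ind2)(Ind3)/hull enlargement of the Θ-side factor volumes) and the `q`-pilot's local log-volume there is
NEGATIVE (`v_ℚ` under a bad place), then the uniform B-INPUT `VolumeTransportAt` FAILS at position `m`: `t ≤ s·t` with
`t < 0 < s − 1` is absurd. So any derivation of the B-INPUT at the frames setting must enlarge the Θ-side factor
volumes beyond those of `q̲^{j²}·𝒪` — the closed form pins WHERE the indeterminacies have to act. NOT a judgement on
Cor. 3.12. [claim: Mochizuki2012, status: disputed] -/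
theorem not_volumeTransportAt_ofFrames_of_scaled_centre (hV : V.Realizes (S.D n))
    (c : ℤ → ∀ (i : Fin T.lstar) (vQ : T.VQ) (k : V.J (Setting.labelSucc i) vQ), V.K (Setting.labelSucc i) vQ k)
    (hc : ∀ (m : ℤ) (i : Fin T.lstar) (vQ : T.VQ),
      thetaBox m (thetaPilotObject sig split) (Setting.labelSucc i) vQ = hullSet (V.K _ vQ) (c m i vQ))
    (m : ℤ) (i : Fin T.lstar) (vQ : T.VQ) {s : ℝ} (hs : 1 < s)
    (hscale : ∀ k : V.J (Setting.labelSucc i) vQ,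
      (V.vol _ vQ k).mulLogvol (c m i vQ k) =
        s * (V.vol _ vQ k).mulLogvol (qCentre (qPilotObject qData) (Setting.labelSucc i) vQ k))
    (hneg : ∑ k, V.w _ vQ k * (V.vol _ vQ k).mulLogvol (qCentre (qPilotObject qData) (Setting.labelSucc i) vQ k)
      < 0) :
    ¬ VolumeTransportAt (Setting.ofFrames n lat sig split qData (V.toRealFrames thetaBox qCentre) hq hadm hfin) m := by
  intro h
  have hle := (volumeTransportAt_ofFrames_iff_of_hullSet lat sig split qData thetaBox qCentre hq hadm hfin hV c hc
    m).1 h i vQ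
  simp_rw [hscale, mul_left_comm _ s, ← Finset.mul_sum] at hle
  nlinarith

end Assembled

end FrameVolumePieces

end Cor312Vol

end IUTFork

end Summit.ABC

end
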